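import Summits.QuantumAdvantage.QuantumAdvantage.Theorems.LinnikCubicClassGroupsDegreeOnePrimesEscapeRayClassWindowDHCore
import Summits.QuantumAdvantage.QuantumAdvantage.Theorems.LinnikCubicClassGroupsDegreeOnePrimesEscapeRayClassWindowNumerics
import Summits.QuantumAdvantage.QuantumAdvantage.Theorems.LinnikCubicClassGroupsDegreeOnePrimesEscapeRayClassDHPrelims
import Summits.QuantumAdvantage.QuantumAdvantage.Theorems.LinnikCubicClassGroupsDegreeOnePrimesEscapeFrobeniusWindowDHNumerics
import Summits.QuantumAdvantage.QuantumAdvantage.Theorems.LinnikCubicClassGroupsDegreeOnePrimesEscapeFrobeniusWindowDHCore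
import Summits.QuantumAdvantage.QuantumAdvantage.Theorems.LinnikCubicClassGroupsDegreeOnePrimesEscapeShortIntervalInputs
import Literature.NumberTheory.LFunctions.RayClassDeuringHeilbronn
import Literature.NumberTheory.LFunctions.RayClassLFunctionExceptionalZero
import HarnessLib

/-!
# Short intervals for cosets of a congruence class group, IV: the smoothed window dichotomy, Deuring–Heilbronn form

Topic `Summits/QuantumAdvantage/QuantumAdvantage/Theorems`, cell B2b-1 (linnik-cubic), PART A (gen 23); helper toward
the crux `DegreeOnePrimesEscape` (stmt-QuantumAdvantage-11543) — the ray-class counterpart of `classWindow_dichotomy_dh`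
(gen 19), at a generic size parameter `Q ≥ Q_𝔪` as in `smoothedFiberSum_dichotomy_dh` (gen 22).  HONEST FRAMING:
value = THEOREM (kernel-checked lemma) — NOT summit progress.

`rayWindow_dichotomy_dh`: for `n > 1`, density constants `b, D, a`, precision `κ > 0`, collar floor `0 < e₀ ≤ 1/4`,
repulsion constant `0 < c₁ ≤ 1` there are `θ, a₁, c` such that for every `K` of degree `n`, every datum `f` killing the
narrow ray `mod 𝔪 ≠ 0`, every `Q ≥ Q_𝔪` with `|G| ≤ Q⁴`, the log-free density in `Q`-form and the repulsion
`c₁Q^{−2} ≤ 1 − β₁`: EITHER no member vanishes at a real point of `(1 − c/(log(|d_K|N𝔪) + log 4), 1)` and for all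
`e₀Q^{−2} ≤ ε₀ ≤ 1/4`, `x ≥ Q^{a₁}`, `0 < η ≤ log 2` with `x^{−θ/8} ≤ 2η`, windows `log x ≤ lo < hi ≤ log x + η`
(`g = windowTest lo hi (ε₀η)`) and cosets `τ`: `‖|G| ψ̃_τ(g) − F(−1)‖ ≤ κxη`; OR a real `ψ₁` has such a zero `β₁` and
`‖|G| ψ̃_τ(g) − F(−1) + ψ₁(τ)⁻¹F(−β₁)‖ ≤ κxη · min(1, (1−β₁) log x)` (Deuring–Heilbronn: `deuringHeilbronn_congruence`,
`ray_zfr_of_zeroRepulsion`, `dh_flat_le`; Landau–Page: `exists_exceptionalZero_congruence_const`).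
References: [LagariasMontgomeryOdlyzko1979, §7, Thm. 5.1]; [ThornerZaman2019, Thm. 3.1, §5]; [ThornerZaman2017, §8];
G. Hoheisel (1930).
-/

noncomputable section

open Complex Real MeasureTheory Set Filter Topology NumberField IsDedekindDomain
open scoped NumberField nonZeroDivisors

namespace Summit.QuantumAdvantage.QuantumAdvantage.Theorems.DegreeOnePrimesEscape

open Literature.NumberTheory.LFunctions Literature.NumberTheory.LFunctions.NumberField
  Literature.NumberTheory.LFunctions.EntireEF Literature.NumberTheory.LFunctions.WindowWeight
  Literature.NumberTheory.LFunctions.AbelianDensity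
open scoped Classical

set_option maxHeartbeats 4000000 in
/-- **The smoothed coset-sum window dichotomy, Deuring–Heilbronn form** (see the module docstring).
[cite: LagariasMontgomeryOdlyzko1979, §7] [cite: ThornerZaman2019, Theorem 3.1] -/
theorem rayWindow_dichotomy_dh (n : ℕ) (hn : 1 < n) {b D a : ℝ} (hb : 0 < b) (hD : 0 < D) (ha : 1 ≤ a)
    {κ : ℝ} (hκ : 0 < κ) {e₀ : ℝ} (he₀ : 0 < e₀) (he₀1 : e₀ ≤ 1 / 4) {c₁ : ℝ} (hc₁ : 0 < c₁) (hc₁1 : c₁ ≤ 1) :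
    ∃ θ a₁ c : ℝ, 0 < θ ∧ θ ≤ 1 / 8 ∧ 1 ≤ a₁ ∧ 0 < c ∧ c ≤ 1 / (8 * ((n : ℝ) ^ 2 + 1)) ∧
    ∀ (K : Type) [Field K] [NumberField K], Module.finrank ℚ K = n →
    ∀ (G : Type) [CommGroup G] [Finite G] (𝔪 : Ideal (𝓞 K)) (f : HeightOneSpectrum (𝓞 K) → G)
      (h𝔪 : 𝔪 ≠ ⊥) (hray : ArtinKillsRay 𝔪 f)
      (hsep : ∀ χ : AddChar (Additive G) ℂ, χ ≠ 0 →
        ∃ v : HeightOneSpectrum (𝓞 K), ¬ 𝔪 ≤ v.asIdeal ∧ χ (Additive.ofMul (f v)) ≠ 1) (Q : ℝ),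
      rayCondQ K 𝔪 ≤ Q → (Nat.card G : ℝ) ≤ Q ^ (4 : ℕ) →
      (∀ (T : ℝ), 1 ≤ T → ∀ u : AddChar (Additive G) ℂ → Finset ℂ,
        (∀ ψ, ∀ ρ ∈ u ψ, rayFamF h𝔪 hray hsep ψ ρ = 0 ∧ 1 / 4 ≤ ρ.re ∧ ρ.re < 1 ∧ |ρ.im| ≤ T) →
        ∀ α : ℝ, α ≤ 1 →
          ∑ ψ, ∑ ρ ∈ u ψ with α ≤ ρ.re, (analyticOrderNatAt (rayFamF h𝔪 hray hsep ψ) ρ : ℝ) ≤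
            D * Real.exp (b * (a * Real.log Q + Real.log (T + 4))) ^ (1 - α)) →
      (∀ ψ₁ : AddChar (Additive G) ℂ, ψ₁ + ψ₁ = 0 → ∀ β₁ : ℝ, β₁ < 1 →
        rayFamF h𝔪 hray hsep ψ₁ β₁ = 0 → c₁ * Q ^ (-(2 : ℝ)) ≤ 1 - β₁) →
      (∀ ε₀ x η lo hi : ℝ, e₀ * Q ^ (-(2 : ℝ)) ≤ ε₀ → ε₀ ≤ 1 / 4 → Q ^ a₁ ≤ x → 0 < η → η ≤ Real.log 2 →
          Real.exp (-(θ / 8) * Real.log x) ≤ 2 * η → Real.log x ≤ lo → lo < hi → hi ≤ Real.log x + η →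
          ∀ τ : G,
          ‖(Nat.card G : ℂ) * (smoothedPsiFiber 𝔪 f τ (windowTest lo hi (ε₀ * η)) : ℂ) -
              fordLaplace (windowTest lo hi (ε₀ * η)) (-1)‖ ≤ κ * x * η) ∨
      ∃ (ψ₁ : AddChar (Additive G) ℂ) (β₁ : ℝ), rayFamF h𝔪 hray hsep ψ₁ β₁ = 0 ∧
          1 - c / (Real.log (((discr K).natAbs : ℝ) * ((Ideal.absNorm 𝔪 : ℕ) : ℝ)) + Real.log 4) < β₁ ∧ β₁ < 1 ∧
          ψ₁ + ψ₁ = 0 ∧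
        ∀ ε₀ x η lo hi : ℝ, e₀ * Q ^ (-(2 : ℝ)) ≤ ε₀ → ε₀ ≤ 1 / 4 → Q ^ a₁ ≤ x → 0 < η → η ≤ Real.log 2 →
          Real.exp (-(θ / 8) * Real.log x) ≤ 2 * η → Real.log x ≤ lo → lo < hi → hi ≤ Real.log x + η →
          ∀ τ : G,
            ‖(Nat.card G : ℂ) * (smoothedPsiFiber 𝔪 f τ (windowTest lo hi (ε₀ * η)) : ℂ) -
                fordLaplace (windowTest lo hi (ε₀ * η)) (-1) +
                (ψ₁ (Additive.ofMul τ))⁻¹ * fordLaplace (windowTest lo hi (ε₀ * η)) (-(β₁ : ℂ))‖ ≤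
              κ * x * η * min 1 ((1 - β₁) * Real.log x) := by
  obtain ⟨c₀, hc₀, hpack⟩ := exists_exceptionalZero_congruence_const n
  obtain ⟨Al, hAl0, hAl⟩ := exists_norm_logDeriv_classGroupLFunction_left_le
  obtain ⟨Cr, hCr0, hCr⟩ := exists_norm_logDeriv_continuation_left_le
  obtain ⟨M, hM1, hM⟩ := TZWeight.exists_smoothTransition_deriv_bound
  obtain ⟨hc₁16, hc₂0⟩ := tailConst_nonneg
  obtain ⟨C, hC, hDH'⟩ := deuringHeilbronn_congruence
  have hlC := leftLineConst_nonneg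
  have hn2 : (2 : ℝ) ≤ n := by exact_mod_cast hn
  have hM0 : 0 ≤ M := by linarith
  have hAC0 : 0 < max Al Cr := lt_max_of_lt_left hAl0
  set c : ℝ := min c₀ (1 / (8 * ((n : ℝ) ^ 2 + 1))) with hcdef
  have hc : 0 < c := lt_min hc₀ (by positivity)
  obtain ⟨hcc₀, hcn⟩ : c ≤ c₀ ∧ c ≤ 1 / (8 * ((n : ℝ) ^ 2 + 1)) := ⟨min_le_left _ _, min_le_right _ _⟩
  set cu : ℝ := min 1 (1 / (6 * C * n)) with hcu
  have hcu0 : 0 < cu := lt_min one_pos (by positivity)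
  obtain ⟨hcu1, hcuC⟩ : cu ≤ 1 ∧ cu ≤ 1 / (6 * C * n) := ⟨min_le_left _ _, min_le_right _ _⟩
  set tA : ℝ := κ * cu / 9 with htA
  set tB : ℝ := κ / 9 with htB
  have htA0 : 0 < tA := by positivity
  have htB0 : 0 < tB := by positivity
  set ΛA : ℝ := Real.log (2 * Real.exp 1 * D / tA + 3) with hΛA
  have hΛA0 : 0 < ΛA := Real.log_pos (by have : 0 < 2 * Real.exp 1 * D / tA := (by positivity); linarith)
  set K₃ : ℝ := 2 + max 0 (Real.log (4 * Real.exp 1 * D * C * n / tB)) / Real.log 3 with hK₃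
  set K₄ : ℝ := 2 + max 0 (Real.log (2 * Real.exp 1 * D / (tB * c₁))) / Real.log 12 with hK₄
  have hlog3 : 0 < Real.log 3 := Real.log_pos (by norm_num)
  have hlog12 : 0 < Real.log 12 := Real.log_pos (by norm_num)
  set θ : ℝ := min (min (1 / (8 * b)) (1 / 8)) (min (c / (6 * ΛA)) (min (1 / (6 * C * n * K₃)) (a / (12 * K₄))))
    with hθ
  have hθ0 : 0 < θ := by positivity
  have hθb : θ * b ≤ 1 / 8 := by
    have h1 : θ ≤ 1 / (8 * b) := (min_le_left _ _).trans (min_le_left _ _)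
    calc θ * b ≤ 1 / (8 * b) * b := mul_le_mul_of_nonneg_right h1 hb.le
      _ = 1 / 8 := by field_simp
  have hθ1 : θ ≤ 1 / 8 := (min_le_left _ _).trans (min_le_right _ _)
  have hθΛ : θ ≤ c / (6 * ΛA) := (min_le_right _ _).trans (min_le_left _ _)
  have hθK₃ : θ ≤ 1 / (6 * C * n * K₃) := (min_le_right _ _).trans ((min_le_right _ _).trans (min_le_left _ _))
  have hθK₄ : θ ≤ a / (12 * K₄) := (min_le_right _ _).trans ((min_le_right _ _).trans (min_le_right _ _))
  have hflatA : 2 * Real.exp 1 * D * Real.exp (-(c / (6 * θ))) ≤ tA :=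
    flat_le_of_theta_le hD hθ0 htA0 (by rw [← hΛA]; exact hθΛ)
  have hθK₃' : 6 * θ * C * n * (2 + max 0 (Real.log (4 * Real.exp 1 * D * C * n / tB)) / Real.log 3) ≤ 1 := by
    rw [← hK₃]; have := (le_div_iff₀ (by positivity : (0:ℝ) < 6 * C * n * K₃)).1 hθK₃; linarith
  have hθK₄' : 12 * θ * (2 + max 0 (Real.log (2 * Real.exp 1 * D / (tB * c₁))) / Real.log 12) ≤ a := by
    rw [← hK₄]; have := (le_div_iff₀ (by positivity : (0:ℝ) < 12 * K₄)).1 hθK₄; linarith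
  set W₀ : ℝ := 512 * ((n : ℝ) + 1) with hW₀
  have hW₀0 : 0 < W₀ := by positivity
  set CJ : ℝ := 338 * W₀ + 96 * (M / (4 * e₀)) * W₀ * (4 * tailConst₁ + tailConst₂) + 108 +
    640 * leftLineConst * (max Al Cr) * (M / (4 * e₀)) with hCJ
  have hc₁0' : 0 ≤ tailConst₁ := by linarith
  obtain ⟨a₁', ha₁'1, habsAll⟩ := absorb_junk (2 * 1 * CJ / (κ / 2 * c₁)) (θ / 2) (by positivity) (by positivity)
    (by linarith)
  obtain ⟨a₁'', ha₁''1, himpAll⟩ := absorb_junk (64 / (κ * c₁)) 1 (by positivity) one_pos le_rfl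
  set a₁ : ℝ := max (max (max a₁' a₁'') (32 / θ)) (max (a / θ) 64) with ha₁
  have ha₁a' : a₁' ≤ a₁ := le_trans (le_trans (le_max_left _ _) (le_max_left _ _)) (le_max_left _ _)
  have ha₁a'' : a₁'' ≤ a₁ := le_trans (le_trans (le_max_right _ _) (le_max_left _ _)) (le_max_left _ _)
  have ha₁32 : 32 / θ ≤ a₁ := le_trans (le_max_right _ _) (le_max_left _ _)
  have ha₁aθ : a / θ ≤ a₁ := le_trans (le_max_left _ _) (le_max_right _ _)
  have ha₁64 : (64 : ℝ) ≤ a₁ := le_trans (le_max_right _ _) (le_max_right _ _)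
  have ha₁1 : 1 ≤ a₁ := by linarith
  refine ⟨θ, a₁, c, hθ0, hθ1, ha₁1, hc, hcn,
    fun K _ _ hKn G _ _ 𝔪 f h𝔪 hray hsep Q hQK hG hdens hrepul ↦ ?_⟩
  have hK : 1 < Module.finrank ℚ K := by rw [hKn]; exact hn
  obtain ⟨hQ12, -, hlogd0, -, hlogQ1, -, -⟩ := raySize_facts h𝔪 hK hQK
  obtain ⟨hQ1, hQ0⟩ : (1 : ℝ) < Q ∧ (0 : ℝ) < Q := ⟨by linarith, by linarith⟩
  have hQa₁ : ∀ {x : ℝ}, Q ^ a₁ ≤ x → Q ≤ x := fun hx ↦ by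
    have := (Real.rpow_le_rpow_of_exponent_le hQ1.le ha₁1).trans hx; rwa [Real.rpow_one] at this
  have hNm1 : (1 : ℝ) ≤ ((Ideal.absNorm 𝔪 : ℕ) : ℝ) := one_le_absNorm_cast h𝔪
  have hlogQ : 2 ≤ Real.log Q := two_lt_log_twelve.le.trans (Real.log_le_log (by norm_num) hQ12)
  have hNm : ((Ideal.absNorm 𝔪 : ℕ) : ℝ) ≤ Q := (absNorm_le_rayCondQ 𝔪).trans hQK
  have hlogNm0 : 0 ≤ Real.log (Ideal.absNorm 𝔪 : ℕ) := Real.log_natCast_nonneg _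
  have hlogNm : Real.log (Ideal.absNorm 𝔪 : ℕ) ≤ Q - 1 := (Real.log_le_log (by linarith) hNm).trans hlogQ1
  have hQm2pos : 0 < Q ^ (-(2 : ℝ)) := Real.rpow_pos_of_pos hQ0 _
  have hQm2le : Q ^ (-(2 : ℝ)) ≤ 1 := Real.rpow_le_one_of_one_le_of_nonpos hQ1.le (by norm_num)
  have hlog2 : Real.log 2 < 0.6931471808 := Real.log_two_lt_d9
  obtain ⟨hLPreal, hLPuniq, hLPsimple⟩ := hpack K hKn G 𝔪 f h𝔪 hray hsep
  have hpack_c₀ : ∀ (ψ : AddChar (Additive G) ℂ) (ρ : ℂ),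
      (((ψ = 0 → dedekindZeta₁ K ρ = 0) ∧ (ψ ≠ 0 → datumL h𝔪 hray hsep ψ ρ = 0)) ∧
        1 - c₀ / (Real.log (((discr K).natAbs : ℝ) * ((Ideal.absNorm 𝔪 : ℕ) : ℝ)) + Real.log (|ρ.im| + 4)) < ρ.re) →
      ρ.im = 0 ∧ ψ + ψ = 0 := fun ψ ρ h ↦ hLPreal ψ ρ h
  have hexcZ : ∀ ψ ρ, rayFamF h𝔪 hray hsep ψ ρ = 0 → rayExcRegion c K 𝔪 ρ →
      ((ψ = 0 → dedekindZeta₁ K ρ = 0) ∧ (ψ ≠ 0 → datumL h𝔪 hray hsep ψ ρ = 0)) ∧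
        1 - c₀ / (Real.log (((discr K).natAbs : ℝ) * ((Ideal.absNorm 𝔪 : ℕ) : ℝ)) + Real.log (|ρ.im| + 4)) < ρ.re := by
    intro ψ ρ h0 hexc
    refine ⟨rayFamZ'_of_eq_zero h𝔪 hray hsep ψ h0, rayLpRegion_mono h𝔪 hcc₀ ?_⟩
    obtain ⟨him, hre⟩ := hexc
    rw [him, abs_zero, zero_add]; exact hre
  have hzfr_c : ∀ (x : ℝ) (ψ : AddChar (Additive G) ℂ) (ρ : ℂ), rayFamF h𝔪 hray hsep ψ ρ = 0 →
      1 / 4 ≤ ρ.re → ρ.re < 1 → |ρ.im| ≤ x → ¬ rayExcRegion c K 𝔪 ρ →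
        ρ.re ≤ 1 - c / (a * Real.log Q + Real.log (|ρ.im| + 4)) :=
    fun x ψ ρ h0 h14 h1 hx hexc ↦ rayZfr_classical h𝔪 hray hsep hK hc hcc₀ ha hQK hpack_c₀ x ψ ρ h0 h14 h1 hx hexc
  have hcore : ∀ (ε₀ x η lo hi : ℝ), e₀ * Q ^ (-(2 : ℝ)) ≤ ε₀ → ε₀ ≤ 1 / 4 → Q ^ a₁ ≤ x → 0 < η →
      η ≤ Real.log 2 → Real.exp (-(θ / 8) * Real.log x) ≤ 2 * η → Real.log x ≤ lo → lo < hi →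
      hi ≤ Real.log x + η → ∀ (cZ : ℝ), 0 < cZ →
      (∀ (ψ : AddChar (Additive G) ℂ) (ρ : ℂ), rayFamF h𝔪 hray hsep ψ ρ = 0 → 1 / 4 ≤ ρ.re →
        ρ.re < 1 → |ρ.im| ≤ x → ¬ rayExcRegion c K 𝔪 ρ →
          ρ.re ≤ 1 - cZ / (a * Real.log Q + Real.log (|ρ.im| + 4))) →
      ∀ (τ : G) (Exc : AddChar (Additive G) ℂ → Finset ℂ),
      (∀ ψ, ∀ ρ ∈ Exc ψ, rayFamF h𝔪 hray hsep ψ ρ = 0 ∧ 0 < ρ.re ∧ ρ.re < 1) →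
      (∀ ψ ρ, rayFamF h𝔪 hray hsep ψ ρ = 0 → 0 < ρ.re → ρ.re < 1 → rayExcRegion c K 𝔪 ρ → ρ ∈ Exc ψ) →
      ‖(Nat.card G : ℂ) * (smoothedPsiFiber 𝔪 f τ (windowTest lo hi (ε₀ * η)) : ℂ) -
          fordLaplace (windowTest lo hi (ε₀ * η)) (-1) +
          ∑ ψ : AddChar (Additive G) ℂ, (ψ (Additive.ofMul τ))⁻¹ *
            ∑ ρ ∈ Exc ψ, (analyticOrderNatAt (rayFamF h𝔪 hray hsep ψ) ρ : ℂ) *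
              fordLaplace (windowTest lo hi (ε₀ * η)) (-ρ)‖ ≤
        (9 / 2 * (2 * Real.exp 1 * D * Real.exp (-(cZ / (6 * θ)))) +
          κ / 2 * c₁ / 2 * Q ^ (-(2 : ℝ)) + κ * c₁ / 4 * Q ^ (-(2 : ℝ))) * x * η := by
    intro ε₀ x η lo hi hε₀Q hε₀1 hx hη0 hη1 hηx hlo hlohi hhi cZ hcZ hzfr_x τ Exc hExc hExc'
    have hε₀0 : 0 < ε₀ := lt_of_lt_of_le (mul_pos he₀ hQm2pos) hε₀Q
    have hxa₁' : Q ^ a₁' ≤ x := (Real.rpow_le_rpow_of_exponent_le hQ1.le ha₁a').trans hx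
    have hxa₁'' : Q ^ a₁'' ≤ x := (Real.rpow_le_rpow_of_exponent_le hQ1.le ha₁a'').trans hx
    have hxaθ : Q ^ (a / θ) ≤ x := (Real.rpow_le_rpow_of_exponent_le hQ1.le ha₁aθ).trans hx
    have hx32 : Q ^ (32 / θ) ≤ x := (Real.rpow_le_rpow_of_exponent_le hQ1.le ha₁32).trans hx
    have hQx : Q ≤ x := hQa₁ hx
    obtain ⟨hx1, hx0⟩ : 1 < x ∧ 0 < x := ⟨by linarith, by linarith⟩
    have hL0 : 0 < Real.log x := Real.log_pos hx1
    have hxexp : Real.exp (Real.log x) = x := Real.exp_log hx0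
    have hLQ : a₁ * Real.log Q ≤ Real.log x := by
      have := Real.log_le_log (by positivity) hx; rwa [Real.log_rpow (by linarith)] at this
    have hL64 : 64 ≤ Real.log x := by nlinarith
    have haθ : a * Real.log Q ≤ θ * Real.log x := by
      have h1 := Real.log_le_log (by positivity) hxaθ
      rw [Real.log_rpow (by linarith)] at h1
      have h2 : θ * (a / θ * Real.log Q) = a * Real.log Q := by field_simp
      have h3 := mul_le_mul_of_nonneg_left h1 hθ0.le
      linarith
    have h2θ : 2 ≤ θ * Real.log x := by
      have := mul_le_mul ha hlogQ (by norm_num) (by linarith : (0 : ℝ) ≤ a); linarith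
    have hQ4 : Q ^ (4 : ℕ) * x ^ (-(θ / 8)) ≤ 1 := pow_four_mul_rpow_le_one hQ0 hx0 hθ0 hx32
    have habs' := habsAll Q x hQ12 hxa₁'
    rw [show -(θ / 2 / 4) = -(θ / 8) by ring] at habs'
    have hjunk1 : (1 : ℝ) * ((338 * W₀ + 96 * (M / (4 * ε₀)) * W₀ * (4 * tailConst₁ + tailConst₂) + 108 +
        640 * leftLineConst * (max Al Cr) * (M / (4 * ε₀))) * Q ^ (7 : ℕ) * (Real.log x + 1) *
        Real.exp (-(θ / 4) * Real.log x)) ≤ κ / 2 * c₁ / 2 * Q ^ (-(2 : ℝ)) :=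
      dh_junk_le one_pos hW₀0.le hM0 hc₁0' hc₂0 hlC hAC0.le he₀ hε₀Q hQ12 hx0 (half_pos hκ) hc₁
        (by rw [← hCJ]; exact habs') hQ4 hL0.le
    rw [one_mul, hW₀] at hjunk1
    have himp := himpAll Q x hQ12 hxa₁''
    rw [show -((1 : ℝ) / 4) = -(1 / 4) by ring] at himp
    have hη1' : η ≤ 1 := by linarith
    have hjunk' : (Nat.card G : ℝ) * (2 * (Real.log x + η + 2) * Real.log (Ideal.absNorm 𝔪 : ℕ)) ≤
        κ * c₁ / 4 * Q ^ (-(2 : ℝ)) * x * η :=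
      imprimitive_junk_le hQ12 hG hlogNm0 hlogNm hx1.le hη0 hη1' hθ0 hθ1 hηx hκ hc₁
        (by rw [show -((1 : ℝ) / 4) = -(1 / 4) by ring]; exact himp)
    have hLX0 : 0 ≤ hi + ε₀ * η := by have : 0 < ε₀ * η := (by positivity); linarith
    have hT₁x : Real.exp (θ * (hi + ε₀ * η)) ≤ x := by
      rw [← hxexp]
      refine Real.exp_le_exp.2 ?_
      have h1 : θ * (hi + ε₀ * η) ≤ 1 / 8 * (hi + ε₀ * η) := mul_le_mul_of_nonneg_right hθ1 hLX0
      have hε1 : ε₀ * η ≤ 1 := by have := mul_le_mul hε₀1 hη1 hη0.le (by norm_num); linarith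
      linarith [hL64]
    have hzfr : ∀ (ψ : AddChar (Additive G) ℂ) (ρ : ℂ), rayFamF h𝔪 hray hsep ψ ρ = 0 → 1 / 4 ≤ ρ.re →
        ρ.re < 1 → |ρ.im| ≤ Real.exp (θ * (hi + ε₀ * η)) → ¬ rayExcRegion c K 𝔪 ρ →
          ρ.re ≤ 1 - cZ / (a * Real.log Q + Real.log (|ρ.im| + 4)) :=
      fun ψ ρ h0 h14 h1 hγ hexc ↦ hzfr_x ψ ρ h0 h14 h1 (hγ.trans hT₁x) hexc
    exact rayWindow_core_dh h𝔪 hray hsep hn hKn hb hD ha hQK hG hdens c hcZ hM1 hM hAl0 hAl hCr0 hCr hθ0 hθb hθ1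
      hx1 haθ h2θ hη0 hη1 hηx hlo hlohi hhi hε₀0 hε₀1 hjunk1 hjunk' hzfr τ Exc hExc hExc'
  clear habsAll himpAll
  by_cases hex : ∃ (ψ : AddChar (Additive G) ℂ) (ρ : ℂ),
      rayFamF h𝔪 hray hsep ψ ρ = 0 ∧ 0 < ρ.re ∧ ρ.re < 1 ∧ rayExcRegion c K 𝔪 ρ
  · -- (B) an exceptional zero `(ψ₁, ρ₁)`: real, unique, simple
    right
    obtain ⟨ψ₁, ρ₁, h0₁, hre₁, hre₁', hexc₁⟩ := hex
    have hZ₁ := hexcZ ψ₁ ρ₁ h0₁ hexc₁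
    obtain ⟨him₁, hreal₁⟩ := hLPreal _ ρ₁ hZ₁
    set β₁ : ℝ := ρ₁.re with hβ₁
    have hρ₁ : ρ₁ = (β₁ : ℂ) := by
      apply Complex.ext <;> simp [hβ₁, him₁]
    have hmult : analyticOrderNatAt (rayFamF h𝔪 hray hsep ψ₁) ρ₁ = 1 := by
      obtain ⟨hs1, hs2⟩ := hLPsimple _ ρ₁ hZ₁
      by_cases hψ : ψ₁ = 0
      · subst hψ
        have h := hs1 rfl
        have hne : analyticOrderAt (dedekindZeta₁ K) ρ₁ ≠ ⊤ := by rw [h]; exact ENat.one_ne_top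
        have : (analyticOrderNatAt (dedekindZeta₁ K) ρ₁ : ℕ∞) = 1 := by
          rw [Nat.cast_analyticOrderNatAt hne, h]
        rw [rayFamF_zero]; exact_mod_cast this
      · have h := hs2 hψ
        have hne : analyticOrderAt (datumData h𝔪 hray hsep ψ₁ hψ).L ρ₁ ≠ ⊤ := by
          rw [h]; exact ENat.one_ne_top
        have : (analyticOrderNatAt (datumData h𝔪 hray hsep ψ₁ hψ).L ρ₁ : ℕ∞) = 1 := by
          rw [Nat.cast_analyticOrderNatAt hne, h]
        rw [rayFamF_of_ne h𝔪 hray hsep hψ]; exact_mod_cast this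
    have hβ1 : β₁ < 1 := hre₁'
    have hβhalf : 1 / 2 ≤ β₁ := by
      have hlog4 : 1 < Real.log 4 := by
        rw [show (4:ℝ) = 2 ^ 2 by norm_num, Real.log_pow]; have := Real.log_two_gt_d9; push_cast; linarith
      have hc2 : c ≤ 1 / 2 :=
        hcn.trans (by rw [div_le_div_iff_of_pos_left one_pos (by positivity) (by norm_num)]; nlinarith)
      have : c / (Real.log (((discr K).natAbs : ℝ) * ((Ideal.absNorm 𝔪 : ℕ) : ℝ)) + Real.log 4) ≤ 1 / 2 := by
        rw [div_le_iff₀ (by linarith)]; nlinarith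
      linarith [hexc₁.2]
    have hβ0 : 0 < β₁ := by linarith
    have h0β : rayFamF h𝔪 hray hsep ψ₁ (β₁ : ℂ) = 0 := by rw [← hρ₁]; exact h0₁
    have hδlow : c₁ * Q ^ (-(2 : ℝ)) ≤ 1 - β₁ := hrepul ψ₁ hreal₁ β₁ hβ1 h0β
    have hexcβ : rayExcRegion c K 𝔪 (β₁ : ℂ) := by rw [← hρ₁]; exact hexc₁
    have hZβ := rayFamZ_of_eq_zero h𝔪 hray hsep ψ₁ h0β
    have hrep : ∀ (ψ : AddChar (Additive G) ℂ) (ρ : ℂ), rayFamF h𝔪 hray hsep ψ ρ = 0 → 1 / 2 ≤ ρ.re →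
        ρ ≠ 1 → ρ ≠ β₁ →
          Real.log (1 / (C * (Real.log (((discr K).natAbs : ℝ) * ((Ideal.absNorm 𝔪 : ℕ) : ℝ)) +
              Module.finrank ℚ K * (Real.log (|ρ.im| + 2) + 1)) * (1 - β₁))) /
            (C * (Real.log (((discr K).natAbs : ℝ) * ((Ideal.absNorm 𝔪 : ℕ) : ℝ)) +
              Module.finrank ℚ K * (Real.log (|ρ.im| + 2) + 1))) ≤ 1 - ρ.re :=
      fun ψ ρ h0 hge hρ1 hρβ ↦ hDH' K G 𝔪 f h𝔪 hray hsep ψ₁ hreal₁ β₁ hβ0 hβ1 hZβ ψ ρ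
        (rayFamZ_of_eq_zero h𝔪 hray hsep ψ h0) hge hρ1 hρβ
    refine ⟨ψ₁, β₁, h0β, hexc₁.2, hβ1, hreal₁,
      fun ε₀ x η lo hi hε₀Q hε₀1 hx hη0 hη1 hηx hlo hlohi hhi τ ↦ ?_⟩
    set Exc : AddChar (Additive G) ℂ → Finset ℂ := fun ψ ↦ if ψ = ψ₁ then {ρ₁} else ∅ with hExcdef
    have hExc : ∀ ψ, ∀ ρ ∈ Exc ψ, rayFamF h𝔪 hray hsep ψ ρ = 0 ∧ 0 < ρ.re ∧ ρ.re < 1 := by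
      intro ψ ρ hρ
      rw [hExcdef] at hρ; dsimp only at hρ
      split_ifs at hρ with hψ
      · rw [Finset.mem_singleton] at hρ; subst hρ; subst hψ; exact ⟨h0₁, hre₁, hre₁'⟩
      · simp at hρ
    have hExc' : ∀ ψ ρ, rayFamF h𝔪 hray hsep ψ ρ = 0 → 0 < ρ.re → ρ.re < 1 → rayExcRegion c K 𝔪 ρ →
        ρ ∈ Exc ψ := by
      intro ψ ρ h0 _ _ hexc
      have hZ := hexcZ ψ ρ h0 hexc
      obtain ⟨hψ, hρρ⟩ := hLPuniq _ _ ρ ρ₁ hZ hZ₁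
      rw [hExcdef]; dsimp only; rw [if_pos hψ, Finset.mem_singleton]; exact hρρ
    have hsum : ∑ ψ : AddChar (Additive G) ℂ, (ψ (Additive.ofMul τ))⁻¹ *
        ∑ ρ ∈ Exc ψ, (analyticOrderNatAt (rayFamF h𝔪 hray hsep ψ) ρ : ℂ) *
          fordLaplace (windowTest lo hi (ε₀ * η)) (-ρ) =
        (ψ₁ (Additive.ofMul τ))⁻¹ * fordLaplace (windowTest lo hi (ε₀ * η)) (-(β₁ : ℂ)) := by
      rw [Finset.sum_eq_single ψ₁]
      · rw [hExcdef]; dsimp only; rw [if_pos rfl, Finset.sum_singleton, hmult, ← hρ₁]; push_cast; ring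
      · intro ψ _ hψ
        rw [hExcdef]; dsimp only; rw [if_neg hψ, Finset.sum_empty, mul_zero]
      · intro h; exact absurd (Finset.mem_univ _) h
    have hQx : Q ≤ x := hQa₁ hx
    obtain ⟨hx1, hx0⟩ : 1 < x ∧ 0 < x := ⟨by linarith, by linarith⟩
    have hLQ : a₁ * Real.log Q ≤ Real.log x := by
      have := Real.log_le_log (by positivity) hx; rwa [Real.log_rpow (by linarith)] at this
    obtain ⟨hL0, hL1⟩ : 0 < Real.log x ∧ 1 ≤ Real.log x := ⟨by nlinarith, by nlinarith⟩
    have hδ₁0 : 0 < 1 - β₁ := by linarith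
    have hμ0 : 0 < (1 - β₁) * Real.log x := mul_pos hδ₁0 hL0
    have hδμ : 1 - β₁ ≤ (1 - β₁) * Real.log x := le_mul_of_one_le_right hδ₁0.le hL1
    have hμlow : c₁ * Q ^ (-(2 : ℝ)) ≤ (1 - β₁) * Real.log x := hδlow.trans hδμ
    have hμlow1 : c₁ * Q ^ (-(2 : ℝ)) ≤ 1 := (mul_le_mul hc₁1 hQm2le hQm2pos.le zero_le_one).trans (by norm_num)
    have hμm : c₁ * Q ^ (-(2 : ℝ)) ≤ min 1 ((1 - β₁) * Real.log x) := le_min hμlow1 hμlow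
    have hj : κ / 2 * c₁ / 2 * Q ^ (-(2 : ℝ)) + κ * c₁ / 4 * Q ^ (-(2 : ℝ)) ≤
        κ / 2 * min 1 ((1 - β₁) * Real.log x) := by
      have := mul_le_mul_of_nonneg_left hμm (by positivity : (0:ℝ) ≤ κ / 2)
      linarith
    rcases le_or_gt cu ((1 - β₁) * Real.log x) with hAreg | hBreg
    · -- regime A: the classical zero-free region suffices
      have key := hcore ε₀ x η lo hi hε₀Q hε₀1 hx hη0 hη1 hηx hlo hlohi hhi c hc (hzfr_c x) τ Exc hExc hExc'
      rw [hsum] at key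
      refine key.trans ?_
      have hmcu : cu ≤ min 1 ((1 - β₁) * Real.log x) := le_min hcu1 hAreg
      have h1 : 9 / 2 * (2 * Real.exp 1 * D * Real.exp (-(c / (6 * θ)))) ≤
          κ / 2 * min 1 ((1 - β₁) * Real.log x) := by
        have h3 := mul_le_mul_of_nonneg_left hflatA (by norm_num : (0 : ℝ) ≤ 9 / 2)
        have e : (9 / 2 : ℝ) * tA = κ / 2 * cu := by rw [htA]; ring
        have h4 := mul_le_mul_of_nonneg_left hmcu (by positivity : (0:ℝ) ≤ κ / 2)
        linarith
      have hsum' : 9 / 2 * (2 * Real.exp 1 * D * Real.exp (-(c / (6 * θ)))) +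
          κ / 2 * c₁ / 2 * Q ^ (-(2 : ℝ)) + κ * c₁ / 4 * Q ^ (-(2 : ℝ)) ≤
          κ * min 1 ((1 - β₁) * Real.log x) := by linarith
      have := mul_le_mul_of_nonneg_right (mul_le_mul_of_nonneg_right hsum' hx0.le) hη0.le
      refine this.trans (le_of_eq ?_)
      ring
    · -- regime B: Deuring–Heilbronn
      have hμ1 : (1 - β₁) * Real.log x ≤ 1 := hBreg.le.trans hcu1
      have hmin : min 1 ((1 - β₁) * Real.log x) = (1 - β₁) * Real.log x := min_eq_right hμ1
      have hsmall : 2 * C * n * ((1 - β₁) * Real.log x) ≤ 1 / 3 := by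
        have h1 : 2 * C * n * ((1 - β₁) * Real.log x) ≤ 2 * C * n * cu :=
          mul_le_mul_of_nonneg_left hBreg.le (by positivity)
        have h2 : 2 * C * n * cu ≤ 2 * C * n * (1 / (6 * C * n)) :=
          mul_le_mul_of_nonneg_left hcuC (by positivity)
        have h3 : 2 * C * n * (1 / (6 * C * n)) = 1 / 3 := by field_simp; ring
        linarith
      have hL4 : 4 ≤ Real.log x := by nlinarith
      set cZ : ℝ := min (Real.log (1 / (2 * C * n * ((1 - β₁) * Real.log x))) / (C * n))
          (a * Real.log Q / 2) with hcZ
      have hcZ0 : 0 < cZ := by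
        refine lt_min (div_pos (Real.log_pos ?_) (by positivity)) (by positivity)
        have h0 : 0 < 2 * C * n * ((1 - β₁) * Real.log x) := by positivity
        rw [lt_div_iff₀ h0]; linarith
      have hzfr_x :=
        ray_zfr_of_zeroRepulsion h𝔪 hray hsep hn hKn hC (c := c) (a := a) ha hQK hexcβ hβ1 hQx hL4 hrep hsmall
      have key := hcore ε₀ x η lo hi hε₀Q hε₀1 hx hη0 hη1 hηx hlo hlohi hhi cZ hcZ0 hzfr_x τ Exc hExc hExc'
      rw [hsum] at key
      refine key.trans ?_
      rw [hmin]
      have hflatB := dh_flat_le (Q := Q) (μ₁ := (1 - β₁) * Real.log x) hC hn2 hD ha hθ0 htB0 hc₁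
        hQ12 hμ0 hμlow hsmall hθK₃' hθK₄'
      have h1 : 9 / 2 * (2 * Real.exp 1 * D * Real.exp (-(cZ / (6 * θ)))) ≤
          κ / 2 * ((1 - β₁) * Real.log x) := by
        have := mul_le_mul_of_nonneg_left hflatB (by norm_num : (0 : ℝ) ≤ 9 / 2)
        have e : (9 / 2 : ℝ) * (tB * ((1 - β₁) * Real.log x)) = κ / 2 * ((1 - β₁) * Real.log x) := by
          rw [htB]; ring
        rw [hcZ]; linarith
      rw [hmin] at hj
      have hsum' : 9 / 2 * (2 * Real.exp 1 * D * Real.exp (-(cZ / (6 * θ)))) +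
          κ / 2 * c₁ / 2 * Q ^ (-(2 : ℝ)) + κ * c₁ / 4 * Q ^ (-(2 : ℝ)) ≤ κ * ((1 - β₁) * Real.log x) := by
        linarith
      have := mul_le_mul_of_nonneg_right (mul_le_mul_of_nonneg_right hsum' hx0.le) hη0.le
      refine this.trans (le_of_eq ?_)
      ring
  · -- (A) no exceptional zero: classical zero-free region, target `κ`
    left
    intro ε₀ x η lo hi hε₀Q hε₀1 hx hη0 hη1 hηx hlo hlohi hhi τ
    have hx0 : 0 < x := by linarith [hQa₁ hx]
    have key := hcore ε₀ x η lo hi hε₀Q hε₀1 hx hη0 hη1 hηx hlo hlohi hhi c hc (hzfr_c x) τ (fun _ ↦ ∅)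
      (fun ψ ρ hρ ↦ by simp at hρ) (fun ψ ρ h0 h1 h2 hexc ↦ absurd ⟨ψ, ρ, h0, h1, h2, hexc⟩ hex)
    simp only [Finset.sum_empty, mul_zero, Finset.sum_const_zero, add_zero] at key
    refine key.trans ?_
    have h1 : 9 / 2 * (2 * Real.exp 1 * D * Real.exp (-(c / (6 * θ)))) ≤ κ / 2 := by
      have h3 := mul_le_mul_of_nonneg_left hflatA (by norm_num : (0 : ℝ) ≤ 9 / 2)
      have e : (9 / 2 : ℝ) * tA = κ * cu / 2 := by rw [htA]; ring
      have h4 : κ * cu ≤ κ * 1 := mul_le_mul_of_nonneg_left hcu1 hκ.le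
      linarith
    have h2 : κ / 2 * c₁ / 2 * Q ^ (-(2 : ℝ)) + κ * c₁ / 4 * Q ^ (-(2 : ℝ)) ≤ κ / 2 := by
      have h3 := mul_le_mul hc₁1 hQm2le hQm2pos.le zero_le_one
      have h4 := mul_le_mul_of_nonneg_left h3 (by positivity : (0 : ℝ) ≤ κ / 2)
      linarith
    have hsum : 9 / 2 * (2 * Real.exp 1 * D * Real.exp (-(c / (6 * θ)))) +
        κ / 2 * c₁ / 2 * Q ^ (-(2 : ℝ)) + κ * c₁ / 4 * Q ^ (-(2 : ℝ)) ≤ κ := by linarith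
    exact mul_le_mul_of_nonneg_right (mul_le_mul_of_nonneg_right hsum hx0.le) hη0.le

end Summit.QuantumAdvantage.QuantumAdvantage.Theorems.DegreeOnePrimesEscape

end
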